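import Summits.BirchSwinnertonDyer.Rank1Residual.P2.CMKolyvaginOddManinTwistRoadAtTwoAtlas
import Summits.BirchSwinnertonDyer.Rank1Residual.P2.CMKolyvaginHabitatTamagawaMordell
import Literature.NumberTheory.EllipticCurves.IsogenyHasCMProofs
import Literature.NumberTheory.EllipticCurves.ComplexMultiplicationTwistIsogenyProofs
import HarnessLib

/-!
# Route `ShiftedKolyvaginAtInertTwo` (leaf `WAllCornerFTwo`), aside `OddManinCMInertTwoR`
# (stmt-BirchSwinnertonDyer-26780): the `j = 0` sector in Mordell currency — the twist road covers
# `y² = x³ + k` with `v₂(k) ≡ 1, 4 (mod 6)`; the residual is `v₂(k) ≡ 0, 2, 3, 5 (mod 6)`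

Cell `bsd-print-cf2`, seat ty2 (discharge interface). Fourth file of the twist road (engine, classes,
atlas, this). HONEST FRAMING: THEOREMS ONLY — no definition, no named fact, no route file imported,
nothing about BSD asserted or booked; the leaf, the route's research cruxes, item 26780 AS TYPED and
Manin's conjecture are OPEN; BSD is NOT proved by any of this.

The atlas file reduced item 26780 to its `j = 0` sector, and there to the curves that are NOT a
`ℚ`-model of a square-free quadratic twist of a globally minimal curve good at `2`. Here that
exception is computed for `y² = x³ + k` (`k ∈ ℤ ∖ {0}`, `a := v₂(k)`, `u := k/2ᵃ`):

* §9 `exists_good_twist_of_smul_mordell_of_factorization_two` (with the tree's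
  `quadraticTwist_mk_a₆`: `(y² = x³ + B)^{(d)} = (y² = x³ + d³B)` on the nose): **if `a ≡ 1` or `4 (mod 6)` then `W` is
  a `ℚ`-model of `E^{(d)}` with `E` globally minimal, `j(E) = 0`, GOOD at `2` and `d ∈ {1, −1, 2, −2}`**
  — explicitly `E ≅ (y² = x³ ± 16u)` with the sign making `±u ≡ 1 (mod 4)` (the tree's criterion
  `Mordell.hasGoodReductionAtPrime_two_of_model_iff`: good at `2` iff `a ≡ 4 (6)` and `u ≡ 1 (4)`), and
  `d = ±1` (`a ≡ 4`), `d = ±2` (`a ≡ 1`: `y² = x³ + 2u ≅ y² = x³ + 128u = (±2)³(±16u)`).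
* §10 `odd_c_of_latticeOptimal_of_smul_mordell_of_factorization_two`: for those `W` (globally
  minimal) every lattice-optimal `X₀`-datum at any level has odd `c`, modulo the four prints (engine).
* §11 `oddManinCMInertTwoR_of_print_of_mordellResidual`: ITEM 26780 VERBATIM ⟸ the four prints +
  ONE residual hypothesis in Mordell currency: «for `W` globally minimal, `W ≅ (y² = x³ + k)` with
  `k ≠ 0`, `v₂(k) mod 3 ≠ 1`, `k` not a cube (= `ρ̄_{W,2}` onto), `r_an(W) = 1`: every lattice-optimal
  `X₀(N_W)`-datum has odd `c`» — the honest open part of 26780, a sub-case of bsd-f2-manin's crux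
  `ManinOddAtFour` (stmt-BirchSwinnertonDyer-22967) by `mordellResidual_of_maninOddAtFour`.

Numbers (informal, not used): `v₂(k) mod 6 ∈ {0, 2, 3, 5}` are the `2`-adic types `II`/`IV`
(`a ≡ 0`: `u ≡ 1, 3 (4)`), `I₀*`/`IV*` (`a ≡ 2`), `I₀*` (`a ≡ 3`), `II*`/`IV*` (`a ≡ 5`) of the
tree's `2`-adic table for `y² = x³ + 2^{a mod 6}u` — all additive at `2` with `v₂(N) ∈ {2, 3, 4, 6}`
minus the dyadic-twist classes; none is a twist by `±1, ±2` of a curve good at `2`, since such a twist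
has `a ≡ 4 ± 0` or `4 + 3 (mod 6)`.

References: [SilvermanATAEC1994] IV.9.4 and Table 4.1; [SilvermanAEC2009] X.5 Prop. 5.4 (iii),
VII.5 Prop. 5.1(a); [Stevens1989] Lemmas (5.2), (5.4); [BarriosEtAl2025] Thm. 5.1; [AbbesUllmo1996]
Thm. A; [Cesnavicius2018] Thm. 1.2; [Mazur1978] Cor. 4.1; [DokchitserDokchitserMathZ2012] Theorem (1).
-/

set_option autoImplicit false

noncomputable section

open scoped Classical NumberField

open WeierstrassCurve NumberField Literature.NumberTheory.EllipticCurves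
  Literature.NumberTheory.EllipticCurves.ModularForms Literature.NumberTheory.EllipticCurves.Rank1Residual
  Literature.NumberTheory.EllipticCurves.Rank1Residual.X11RankOneCertificates
  Summit.BirchSwinnertonDyer.Rank1Residual Summit.BirchSwinnertonDyer.Rank1Residual.X11b
  Summit.BirchSwinnertonDyer.Rank1Residual.P2

namespace Summit.BirchSwinnertonDyer.Rank1Residual.P2.OddManinTwistRoad

/-! ## §9 `y² = x³ + k` with `v₂(k) ≡ 1, 4 (mod 6)` is a dyadic twist of a `j = 0` curve good at `2` -/

/-- `v₂(16·u₀) = 4` and `16u₀ / 2⁴ = u₀` for odd `u₀`. [folklore] -/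
theorem factorization_two_sixteen_mul {u₀ : ℤ} (hu : ¬ (2 : ℤ) ∣ u₀) :
    (16 * u₀).natAbs.factorization 2 = 4 ∧
      (16 * u₀) / (2 : ℤ) ^ (16 * u₀).natAbs.factorization 2 = u₀ := by
  have hu0 : u₀ ≠ 0 := by rintro rfl; exact hu (dvd_zero 2)
  have hfac : (16 * u₀).natAbs.factorization 2 = 4 := by
    rw [Int.natAbs_mul, show (16 : ℤ).natAbs = 2 ^ 4 by rfl,
      Nat.factorization_mul (pow_ne_zero 4 two_ne_zero) (Int.natAbs_ne_zero.mpr hu0),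
      Finsupp.add_apply, Nat.prime_two.factorization_pow, Finsupp.single_eq_same,
      Nat.factorization_eq_zero_of_not_dvd (fun h => hu (Int.natCast_dvd.mpr h))]
  refine ⟨hfac, ?_⟩
  rw [hfac]
  omega

/-- **Tail of the construction.** If a `ℚ`-model of `W` IS `(y² = x³ + k₀)^{(d)}` with `k₀ ≠ 0`
satisfying the good-at-2 criterion (`v₂(k₀) ≡ 4 (6)`, `k₀/2^{v₂} ≡ 1 (4)`) and `d ≠ 0` square-free,
then `W` is a `ℚ`-model of `E^{(d)}` for the globally minimal model `E` of `y² = x³ + k₀`, which is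
good at `2` (`Mordell.hasGoodReductionAtPrime_two_of_model_iff`; transport `quadraticTwist_smul`).
[cite: SilvermanATAEC1994, IV.9.4 and Table 4.1] [cite: SilvermanAEC2009, VII.5 Prop. 5.1(a)] -/
theorem exists_good_twist_of_smul_eq_twist_mordell (W : WeierstrassCurve ℚ) [W.IsElliptic]
    {k₀ d : ℤ} (hk₀ : k₀ ≠ 0)
    (hgood : k₀.natAbs.factorization 2 % 6 = 4 ∧ k₀ / (2 : ℤ) ^ k₀.natAbs.factorization 2 % 4 = 1)
    (hd0 : d ≠ 0) (hsq : Squarefree d) {D : VariableChange ℚ}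
    (hD : D • W = (⟨0, 0, 0, 0, (k₀ : ℚ)⟩ : WeierstrassCurve ℚ).quadraticTwist (d : ℚ)) :
    ∃ (E : WeierstrassCurve ℚ) (_ : E.IsElliptic) (_ : E.IsGloballyMinimal),
      E.HasGoodReductionAtPrime 2 ∧ ∃ d : ℤ, d ≠ 0 ∧ Squarefree d ∧
        ∃ C : VariableChange ℚ, C • W = E.quadraticTwist (d : ℚ) := by
  set E₀ : WeierstrassCurve ℚ := ⟨0, 0, 0, 0, (k₀ : ℚ)⟩ with hE₀
  haveI : E₀.IsElliptic := isElliptic_mk_a₆ two_ne_zero three_ne_zero (by exact_mod_cast hk₀)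
  obtain ⟨u, hu⟩ := hasGlobalMinimalModel_rat_holds E₀
  haveI := hu
  have hgoodE : (u • E₀).HasGoodReductionAtPrime 2 :=
    (Mordell.hasGoodReductionAtPrime_two_of_model_iff (u • E₀) hk₀ (C := u) rfl).mpr hgood
  refine ⟨u • E₀, inferInstance, hu, hgoodE, d, hd0, hsq, ⟨u.u, (d : ℚ) * u.r, 0, 0⟩ * D, ?_⟩
  rw [mul_smul, hD, ← quadraticTwist_smul]

/-- **`v₂(k) ≡ 1, 4 (mod 6)` ⟹ `y² = x³ + k` is a square-free twist of a globally minimal `j = 0`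
curve GOOD at `2`.** With `a = v₂(k)`, `u = k/2ᵃ` and the reduced model `y² = x³ + 2^{a mod 6}u`
(`Mordell.exists_smul_eq_reduced`): `a ≡ 4`: `y² = x³ + 16u = (y² = x³ ± 16u)^{(±1)}`; `a ≡ 1`:
`y² = x³ + 2u ≅ y² = x³ + 128u = (y² = x³ ± 16u)^{(±2)}` (`Mordell.powScale_smul`), the sign chosen
with `±u ≡ 1 (mod 4)` so that `y² = x³ ± 16u` is good at `2`.
[cite: SilvermanATAEC1994, IV.9.4 and Table 4.1] [cite: SilvermanAEC2009, X.5 Prop. 5.4 (iii)] -/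
theorem exists_good_twist_of_smul_mordell_of_factorization_two (W : WeierstrassCurve ℚ) [W.IsElliptic]
    {k : ℤ} (hk : k ≠ 0) {C : VariableChange ℚ}
    (hC : C • (⟨0, 0, 0, 0, (k : ℚ)⟩ : WeierstrassCurve ℚ) = W)
    (ha : k.natAbs.factorization 2 % 3 = 1) :
    ∃ (E : WeierstrassCurve ℚ) (_ : E.IsElliptic) (_ : E.IsGloballyMinimal),
      E.HasGoodReductionAtPrime 2 ∧ ∃ d : ℤ, d ≠ 0 ∧ Squarefree d ∧
        ∃ C : VariableChange ℚ, C • W = E.quadraticTwist (d : ℚ) := by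
  obtain ⟨D, hD⟩ :=
    Mordell.exists_smul_eq_reduced Nat.prime_two hk W (Mordell.exists_smul_eq_mordell W hC)
  obtain ⟨-, hup, hu0⟩ := Mordell.eq_pow_mul_reduced (k := k) Nat.prime_two hk
  simp only [Nat.cast_ofNat] at hD hup hu0
  set a := k.natAbs.factorization 2 with ha_def
  set u : ℤ := k / (2 : ℤ) ^ a with hu_def
  have hu4 : u % 4 = 1 ∨ u % 4 = 3 := by omega
  have hsq1 : Squarefree (1 : ℤ) := squarefree_one
  have hsqm1 : Squarefree (-1 : ℤ) := Int.squarefree_natAbs.mp (by simp)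
  have hsq2 : Squarefree (2 : ℤ) := Int.prime_two.squarefree
  have hsqm2 : Squarefree (-2 : ℤ) := Int.prime_two.neg.squarefree
  rcases (show a % 6 = 1 ∨ a % 6 = 4 by omega) with h1 | h4
  · -- `y² = x³ + 2u ≅ y² = x³ + 128u = (y² = x³ ± 16u)^{(±2)}`
    rw [h1, pow_one] at hD
    have hD' : ((⟨Units.mk0 ((2 : ℚ) ^ 1) (pow_ne_zero _ two_ne_zero), 0, 0, 0⟩ :
        VariableChange ℚ)⁻¹ * D) • W = ⟨0, 0, 0, 0, (2 : ℚ) ^ (6 * 1) * (((2 * u : ℤ)) : ℚ)⟩ := by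
      rw [mul_smul, hD, ← Mordell.powScale_smul two_ne_zero 1 (((2 * u : ℤ)) : ℚ), inv_smul_smul]
    rcases hu4 with h41 | h43
    · obtain ⟨hf, hq⟩ := factorization_two_sixteen_mul hup
      refine exists_good_twist_of_smul_eq_twist_mordell W (k₀ := 16 * u) (d := 2)
        (mul_ne_zero (by norm_num) hu0) ⟨by rw [hf], by rw [hq]; exact h41⟩ two_ne_zero hsq2
        (D := _) (hD'.trans ?_)
      rw [quadraticTwist_mk_a₆]; congr 1; push_cast; ring
    · have hnd : ¬ (2 : ℤ) ∣ -u := fun h => hup (dvd_neg.mp h)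
      obtain ⟨hf, hq⟩ := factorization_two_sixteen_mul hnd
      refine exists_good_twist_of_smul_eq_twist_mordell W (k₀ := 16 * -u) (d := -2)
        (mul_ne_zero (by norm_num) (neg_ne_zero.mpr hu0)) ⟨by rw [hf], by rw [hq]; omega⟩
        (neg_ne_zero.mpr two_ne_zero) hsqm2 (D := _) (hD'.trans ?_)
      rw [quadraticTwist_mk_a₆]; congr 1; push_cast; ring
  · -- `y² = x³ + 16u = (y² = x³ ± 16u)^{(±1)}`
    rw [h4] at hD
    rcases hu4 with h41 | h43
    · obtain ⟨hf, hq⟩ := factorization_two_sixteen_mul hup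
      refine exists_good_twist_of_smul_eq_twist_mordell W (k₀ := 16 * u) (d := 1)
        (mul_ne_zero (by norm_num) hu0) ⟨by rw [hf], by rw [hq]; exact h41⟩ one_ne_zero hsq1
        (D := D) (hD.trans ?_)
      rw [quadraticTwist_mk_a₆]; congr 1; push_cast; ring
    · have hnd : ¬ (2 : ℤ) ∣ -u := fun h => hup (dvd_neg.mp h)
      obtain ⟨hf, hq⟩ := factorization_two_sixteen_mul hnd
      refine exists_good_twist_of_smul_eq_twist_mordell W (k₀ := 16 * -u) (d := -1)
        (mul_ne_zero (by norm_num) (neg_ne_zero.mpr hu0)) ⟨by rw [hf], by rw [hq]; omega⟩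
        (neg_ne_zero.mpr one_ne_zero) hsqm1 (D := D) (hD.trans ?_)
      rw [quadraticTwist_mk_a₆]; congr 1; push_cast; ring

/-! ## §10 Odd Manin constant on the covered part of the `j = 0` sector -/

/-- **`W` globally minimal, `W ≅ (y² = x³ + k)` with `v₂(k) ≡ 1, 4 (mod 6)`: every lattice-optimal
`X₀`-datum of `W` at any level has ODD `c`**, modulo Mazur 1978 Cor. 4.1 (`hM`), Abbes–Ullmo 1996
Thm. A (`hAU`), Česnavičius 2018 Thm. 1.2 (`hC2`), modularity (`hnf`): §9 and the engine of the twist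
road. [cite: Stevens1989, Lemmas (5.2), (5.4)] [cite: BarriosEtAl2025, Thm. 5.1]
[cite: AbbesUllmo1996, Thm. A] [cite: Cesnavicius2018, Thm. 1.2] [cite: Mazur1978, Cor. 4.1] -/
theorem odd_c_of_latticeOptimal_of_smul_mordell_of_factorization_two
    (hM : mazur_not_dvd_maninConstant_of_odd)
    (hAU : abbesUllmo_not_dvd_maninConstant_of_not_dvd_level)
    (hC2 : cesnavicius_not_two_dvd_maninConstant_of_two_dvd_level) (hnf : exists_isNewformOf)
    (W : WeierstrassCurve ℚ) [W.IsElliptic] [W.IsGloballyMinimal]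
    {k : ℤ} (hk : k ≠ 0) {C : VariableChange ℚ}
    (hC : C • (⟨0, 0, 0, 0, (k : ℚ)⟩ : WeierstrassCurve ℚ) = W)
    (ha : k.natAbs.factorization 2 % 3 = 1)
    {N : ℕ} [NeZero N] (Dt : ModularParametrizationData W N)
    (hopt : ∀ z ∈ Dt.L.lattice, ∃ w ∈ periodLattice Dt.f, z = (Dt.c : ℂ) * w) : Odd Dt.c := by
  obtain ⟨E, _, _, hE, d, hd0, hsq, C', hC'⟩ :=
    exists_good_twist_of_smul_mordell_of_factorization_two W hk hC ha
  exact odd_c_of_latticeOptimal_of_smul_eq_quadraticTwist_of_hasGoodReductionAtPrime_two hM hAU hC2 hnf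
    hE hd0 hsq W hC' Dt hopt

/-! ## §11 Item 26780 verbatim from the prints and the Mordell-currency residual -/

/-- **ITEM 26780 ⟸ prints + the `j = 0` residual in MORDELL CURRENCY.** The body of aside 26780
(route `ShiftedKolyvaginAtInertTwo`, rev 13) VERBATIM follows from `hM hAU hC2 hnf` and
`hK` = «for `W` globally minimal, `W ≅ (y² = x³ + k)` with `k ∈ ℤ ∖ {0}`, `v₂(k) mod 3 ≠ 1`, `k` not
an integer cube, `r_an(W) = 1`: every lattice-optimal `X₀(N_W)`-datum of `W` has odd `c`». Proof:
`j(W) ≠ 0` ⟹ the atlas door; `j(W) = 0` ⟹ `W ≅ (y² = x³ + k)`, `k ∈ ℤ ∖ {0}`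
(`CornerFTwo.Atlas.exists_smul_sextic_int_of_j_eq_zero`); `v₂(k) mod 3 = 1` ⟹ §10; else `hK`, the
image binder read as «`k` not a cube» (`Mordell.hasSurjectiveModNGaloisRep_two_of_model_iff_int`).
[cite: SilvermanAEC2009, X.5 Prop. 5.4] [cite: DokchitserDokchitserMathZ2012, Theorem (1)]
[cite: Stevens1989, Lemmas (5.2), (5.4)] [cite: Cesnavicius2018, Thm. 1.2] [cite: AbbesUllmo1996, Thm. A]
[cite: Mazur1978, Cor. 4.1] -/
theorem oddManinCMInertTwoR_of_print_of_mordellResidual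
    (hM : mazur_not_dvd_maninConstant_of_odd)
    (hAU : abbesUllmo_not_dvd_maninConstant_of_not_dvd_level)
    (hC2 : cesnavicius_not_two_dvd_maninConstant_of_two_dvd_level) (hnf : exists_isNewformOf)
    (hK : ∀ (W : WeierstrassCurve ℚ) [W.IsElliptic] [W.IsGloballyMinimal] [NeZero (W.conductorNorm ℤ)]
      (k : ℤ), k ≠ 0 →
      (∃ C : VariableChange ℚ, C • (⟨0, 0, 0, 0, (k : ℚ)⟩ : WeierstrassCurve ℚ) = W) →
      k.natAbs.factorization 2 % 3 ≠ 1 → (¬ ∃ t : ℤ, t ^ 3 = k) → W.analyticRank = 1 →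
      ∀ (Dt : ModularParametrizationData W (W.conductorNorm ℤ)),
        (∀ z ∈ Dt.L.lattice, ∃ w ∈ periodLattice Dt.f, z = (Dt.c : ℂ) * w) → Odd Dt.c) :
    ∀ (W : WeierstrassCurve ℚ) [W.IsElliptic] [W.IsGloballyMinimal] [NeZero (W.conductorNorm ℤ)],
      W.HasCM → Literature.NumberTheory.EllipticCurves.Rank1Residual.CMInert W 2 →
      W.HasSurjectiveModNGaloisRep (2 : ℤ) → W.analyticRank = 1 →
      ∀ (Dt : ModularParametrizationData W (W.conductorNorm ℤ)),
        (∀ z ∈ Dt.L.lattice, ∃ w ∈ periodLattice Dt.f, z = (Dt.c : ℂ) * w) → Odd Dt.c := by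
  intro W _ _ _ hCM hin hρ hr Dt hopt
  by_cases hj0 : W.j = 0
  · obtain ⟨k, hk, C, hC⟩ := CornerFTwo.Atlas.exists_smul_sextic_int_of_j_eq_zero (W := W) hj0
    by_cases ha : k.natAbs.factorization 2 % 3 = 1
    · exact odd_c_of_latticeOptimal_of_smul_mordell_of_factorization_two hM hAU hC2 hnf W hk hC ha
        Dt hopt
    · exact hK W k hk ⟨C, hC⟩ ha
        ((Mordell.hasSurjectiveModNGaloisRep_two_of_model_iff_int W hC).mp hρ) hr Dt hopt
  · exact odd_c_of_latticeOptimal_of_cmInert_two_of_j_ne_zero hM hAU hC2 hnf W hCM hin hρ hj0 Dt hopt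

/-- **The Mordell-currency residual is a sub-case of crux 22967** (`ManinOddAtFour`, body verbatim
as `h4`): it holds GIVEN the prints and `h4` (§5 `odd_c_of_latticeOptimal_of_maninOddAtFour`; none of
the extra binders is used). [cite: AbbesUllmo1996, Thm. A] [cite: Cesnavicius2018, Thm. 1.2]
[cite: Mazur1978, Cor. 4.1] -/
theorem mordellResidual_of_maninOddAtFour
    (hM : mazur_not_dvd_maninConstant_of_odd)
    (hAU : abbesUllmo_not_dvd_maninConstant_of_not_dvd_level)
    (hC2 : cesnavicius_not_two_dvd_maninConstant_of_two_dvd_level) (hnf : exists_isNewformOf)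
    (h4 : mazur_not_dvd_maninConstant_of_odd → abbesUllmo_not_dvd_maninConstant_of_not_dvd_level →
      cesnavicius_not_two_dvd_maninConstant_of_two_dvd_level → exists_isNewformOf →
      ∀ (W : WeierstrassCurve ℚ) [W.IsElliptic] [W.IsGloballyMinimal] {N : ℕ} [NeZero N]
        (D : ModularParametrizationData W N),
        (∀ z ∈ D.L.lattice, ∃ w ∈ periodLattice D.f, z = D.c * w) → 2 ^ 2 ∣ N →
        ¬ (2 : ℤ) ∣ D.maninConstant) :
    ∀ (W : WeierstrassCurve ℚ) [W.IsElliptic] [W.IsGloballyMinimal] [NeZero (W.conductorNorm ℤ)]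
      (k : ℤ), k ≠ 0 →
      (∃ C : VariableChange ℚ, C • (⟨0, 0, 0, 0, (k : ℚ)⟩ : WeierstrassCurve ℚ) = W) →
      k.natAbs.factorization 2 % 3 ≠ 1 → (¬ ∃ t : ℤ, t ^ 3 = k) → W.analyticRank = 1 →
      ∀ (Dt : ModularParametrizationData W (W.conductorNorm ℤ)),
        (∀ z ∈ Dt.L.lattice, ∃ w ∈ periodLattice Dt.f, z = (Dt.c : ℂ) * w) → Odd Dt.c :=
  fun W _ _ _ _ _ _ _ _ _ Dt hopt ↦ odd_c_of_latticeOptimal_of_maninOddAtFour hM hAU hC2 hnf h4 W Dt hopt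

end Summit.BirchSwinnertonDyer.Rank1Residual.P2.OddManinTwistRoad

end
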